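import Summits.QuantumFields.GaugeBoot.Certificates.N2c1D4Tab
import Summits.QuantumFields.GaugeBoot.Rows.GLYZc1D4Ent
import HarnessLib

/-!
# Bridge: lean1's `GLYZc1D4.redBlock` interface ↔ the family tables `N2c1D4` (gb_lean_emit_reduced 0.8)

HONEST FRAMING (cell `pub-gaugeboot`): certified bounds on lattice expectations at stated coupling,
gauge group, dimension and torus size; NOT a mass gap, NOT a continuum limit, NOT a string tension;
NOT Yang–Mills-summit-bearing (barriers `FixedCouplingUltralocality`, `PerturbativeInvisibility`).

Lead ruling A129 (1) (INTERFACE = A, one ∀-hypothesis): the 24 glyz-c1-4D certificate halves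
(CERTIFIED rows C20–C31) take `hpsd : ∀ k : Fin 34, (GLYZc1D4.redBlock k y).PosSemidef` over lean1's
`Rows/GLYZc1D4Ent.lean` (packed table `GLYZc1D4.ent`, p257985).  The certificate kernel checks
(position lists, cover, traces; `Certificates/SparseReduced*.lean`) run over the list tables
`N2c1D4.EB` (`Certificates/N2c1D4EntA/B.lean`, an independent transcription of the same 24 problem
files).  This module checks IN THE KERNEL that the two transcriptions agree on every entry of every
block (`bridge_chk`: for all `k < 34`, `bdim k = dimL[k]` and for all `i, j < bdim k`,
`GLYZc1D4.ent k i j = Sparse.ent EB k i j` as lists), identifies lean1's evaluation `SVec.eval (yN y)`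
with `Sparse.evalComb`, and transfers positive semidefiniteness:
`redE_posSemidef_of_redBlock : (GLYZc1D4.redBlock k y).PosSemidef → (Sparse.redE EB k (dimL[k]) 1079 y).PosSemidef`
(the reduced block used by `Sparse.objective_bound_red`).  Nothing is claimed about lattice gauge
theory in this file.
-/

namespace Summit.QuantumFields.GaugeBoot.Certificates.N2c1D4

noncomputable section

open Matrix Summit.QuantumFields.GaugeBoot.Certificates.Sparse
open Summit.QuantumFields.GaugeBoot (GLYZc1D4.bdim GLYZc1D4.ent GLYZc1D4.yN GLYZc1D4.redBlock
  GLYZc1D4.SVec.eval)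

/-- Boolean agreement check of the two transcriptions: dimensions, and every in-range entry of
every block as a list of (variable, coefficient) pairs. -/
def bridgeChk : Bool :=
  (List.finRange 34).all fun k =>
    (GLYZc1D4.bdim k == dimL.getD k.val 0) &&
      natAll (GLYZc1D4.bdim k) fun i => natAll (GLYZc1D4.bdim k) fun j =>
        GLYZc1D4.ent k i j == Sparse.ent EB k.val i j

set_option maxHeartbeats 0 in
/-- Kernel check: lean1's packed table and the list tables agree (34 blocks, 3870 in-range entries). -/
theorem bridge_chk : bridgeChk = true := by
  decide +kernel

/-- The block dimensions agree. -/
theorem bdim_eq (k : Fin 34) : GLYZc1D4.bdim k = dimL.getD k.val 0 := by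
  have h := List.all_eq_true.mp bridge_chk k (List.mem_finRange k)
  simp only [Bool.and_eq_true, beq_iff_eq] at h
  exact h.1

/-- The entries agree in range. -/
theorem ent_eq (k : Fin 34) {i j : ℕ} (hi : i < GLYZc1D4.bdim k) (hj : j < GLYZc1D4.bdim k) :
    GLYZc1D4.ent k i j = Sparse.ent EB k.val i j := by
  have h := List.all_eq_true.mp bridge_chk k (List.mem_finRange k)
  simp only [Bool.and_eq_true, beq_iff_eq] at h
  have h2 := natAll_iff.mp (natAll_iff.mp h.2 i hi) j hj
  exact beq_iff_eq.mp h2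

/-- lean1's evaluation of a sparse form at `yN y` is `Sparse.evalComb`. -/
theorem eval_yN_eq_evalComb (y : Fin 1079 → ℝ) :
    ∀ L : List (ℕ × ℤ), GLYZc1D4.SVec.eval (GLYZc1D4.yN y) L = Sparse.evalComb L y
  | [] => by simp
  | (v, c) :: rest => by
      rw [GLYZc1D4.SVec.eval_cons, evalComb_cons, eval_yN_eq_evalComb y rest]
      congr 1
      by_cases hv : v < 1079
      · rw [dif_pos hv]; simp [GLYZc1D4.yN, hv]
      · rw [dif_neg hv]; simp [GLYZc1D4.yN, hv]

/-- The certificate-side reduced block is lean1's `redBlock`, re-indexed along `dimL[k] = bdim k`. -/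
theorem redE_eq_submatrix (k : Fin 34) (y : Fin 1079 → ℝ) :
    Sparse.redE EB k.val (dimL.getD k.val 0) 1079 y =
      (GLYZc1D4.redBlock k y).submatrix (Fin.cast (bdim_eq k).symm) (Fin.cast (bdim_eq k).symm) := by
  ext i j
  have hi : i.val < GLYZc1D4.bdim k := (bdim_eq k).symm ▸ i.isLt
  have hj : j.val < GLYZc1D4.bdim k := (bdim_eq k).symm ▸ j.isLt
  rw [redE_apply, Matrix.submatrix_apply, GLYZc1D4.redBlock, Matrix.of_apply, Fin.val_cast,
    Fin.val_cast, ent_eq k hi hj, eval_yN_eq_evalComb]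

/-- **PSD transfer**: lean1's reduced block `k` PSD ⇒ the certificate-side reduced block `k` PSD. -/
theorem redE_posSemidef_of_redBlock (k : Fin 34) (y : Fin 1079 → ℝ)
    (h : (GLYZc1D4.redBlock k y).PosSemidef) :
    (Sparse.redE EB k.val (dimL.getD k.val 0) 1079 y).PosSemidef := by
  rw [redE_eq_submatrix]; exact h.submatrix _

end

end Summit.QuantumFields.GaugeBoot.Certificates.N2c1D4
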